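import Literature.NumberTheory.Automorphic.PiOfArtinRepAuxiliaryCharactersProofs
import Literature.NumberTheory.Automorphic.PiOfArtinRepChevalleyLemmasProofs
import HarnessLib

/-!
# Gelbart's Prop. 4.1 (both unramified shadows): the auxiliary Hecke characters of
Jacquet–Langlands' Lemma 12.5 from Chevalley's congruence subgroup theorem (pure proofs; companion
to `Automorphic/PiOfArtinRepAuxiliaryCharactersProofs`)

`frobSatakeCompatibleAt_of_isPiOfArtinRep_both_of_heckeCharacters` displays, besides the twisted
Hecke theory `HT` of `GL(2)`, the idelic hypothesis `Hη` (Jacquet–Langlands 1970, Lemma 12.5 in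
the order form): for a finite place `v`, a finite set `S ∌ v` of finite places and `N` there is a
Hecke character `η` of finite order, unramified at `v` with `η(ϖ_v) = 1`, such that `η^k` is
ramified at every `w ∈ S` for `0 < k ≤ N`.  This file **proves `Hη`** from the tree's class
field theory of ray class characters (`GaloisRepresentations.heckeOfRayClass`: the finite-order
Hecke character of a ray class character, Cassels–Fröhlich VII Prop. 4.1 / Neukirch VI (1.9),
VII (6.13)–(6.14); `NumberFields.primeClass`, `artinHom_primeClass_eq_mk`,
`finite_rayClassGroup`) and the one arithmetic input that is not in the tree, displayed as the
hypothesis `Chev`: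

* `Chev` — **Chevalley's congruence subgroup theorem for the `{v}`-units** (C. Chevalley, *Deux
  théorèmes d'arithmétique*, J. Math. Soc. Japan 3 (1951), Thm. 1: for a finitely generated
  subgroup `E ⊂ F^×` and `n ≥ 1` there is a modulus `𝔪`, prime to any given ideal, such that
  every `x ∈ E` with `x ≡ 1 (mod 𝔪)` is an `n`-th power in `E`), in the special case used by
  Jacquet–Langlands: for finite places `w ≠ v`, a finite set `S₀` of finite places and `m`,
  there are a finite set `T` of finite places disjoint from `S₀` and exponents `e` such that
  every `x ∈ F^×` which is a unit at all finite places `≠ v` and satisfies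
  `|x - 1|_t ≤ q_t^{-e_t}` for `t ∈ T` satisfies `|x - 1|_w ≤ q_w^{-m}` (apply Thm. 1 to the
  `{v}`-units `E`, finitely generated by the `S`-unit theorem, and `n = [E : E_m]`,
  `E_m = {x ∈ E : x ≡ 1 mod 𝔭_w^m}`).

Construction (`exists_heckeCharacter_of_chevalley_one`, one place `w` at a time; Jacquet–Langlands
1970, proof of Lemma 12.5, made explicit): let `a = 1 + N(𝔭_w)` and `m` with `a^k ≢ 1 mod 𝔭_w^m`
for `0 < k ≤ N` (`exists_unit_pow_sub_one`); take `T, e` from `Chev` for `(v, w, m)` avoiding `S₀`,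
`v`, `w` and the support of `a`; let `𝔪 = 𝔭_w^m ∏_{t ∈ T} 𝔭_t^{e_t}` and move the local idele
`y = ⟨a⟩_w` into the congruence subgroup `W_𝔪` by a principal idele `(b)`
(`exists_principalIdele_mul_mem_congruenceIdeles`); then `(b)` is prime to `𝔪`.  In the finite
ray class group `Cl^𝔪` let `c = [(b)]`, `d = [𝔭_v]`, and let `χ` be a character trivial on
`⟨d⟩` and faithful on `⟨c⟩ mod ⟨d⟩` (`exists_monoidHom_apply_pow_eq_one_imp`); the Hecke character
`η = heckeOfRayClass` of the ray class character `𝔭 ↦ χ([𝔭])` is of finite order, unramified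
off `𝔪` (so at `v` and on `S₀ ∖ {w}`), has `η(ϖ_v) = χ(d) = 1`, and `η(y) = ω₀((b) y) = χ(c)`
(`rayIdeleValue_principalIdele_eq_apply_mk`).  If `η^k` were unramified at `w` (`0 < k ≤ N`) then
`χ(c)^k = 1`, so `c^k = d^j`, i.e. `(b)^k 𝔭_v^{-j} = (r)` with `r ≡ 1 mod 𝔪` totally positive;
`x = b^k / r` is then a unit off `v` with `x ≡ 1 mod 𝔭_t^{e_t}` (`(b)^k y^k ∈ W_𝔪`), so `Chev`
gives `x ≡ 1 mod 𝔭_w^m`, hence `b^k ≡ 1`, and with `b^k a^k ≡ 1 mod 𝔭_w^m` (again `W_𝔪`)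
`a^k ≡ 1 mod 𝔭_w^m` — a contradiction.  The characters for the places of `S` are then
multiplied together (`exists_heckeCharacter_of_chevalley`; each is unramified at the other places
of `S`).

* `exists_heckeCharacter_of_chevalley_one`, `exists_heckeCharacter_of_chevalley` — `Chev ⟹ Hη`.
* `frobSatakeCompatibleAt_of_isPiOfArtinRep_both_of_chevalley` — **both named facts
  `frobSatakeCompatibleAt_of_isPiOfArtinRep` and
  `frobSatakeCompatibleAt_of_isPiOfArtinRep_of_isUnramifiedAt` (Gelbart 1997, Prop. 4.1) from
  `Chev` and `HT`**: all of Jacquet–Langlands' proof of Thm. 12.2 / Cor. 11.2 for `π = π(σ)`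
  except Chevalley's theorem and the Hecke theory of `GL(2)` itself is now in the tree.

No definition and no named fact is introduced (D-0026).

## References

* H. Jacquet, R. P. Langlands, *Automorphic Forms on GL(2)*, LNM 114 (1970), Lemma 12.5 and
  proof of Thm. 12.2. [JacquetLanglands1970]
* C. Chevalley, *Deux théorèmes d'arithmétique*, J. Math. Soc. Japan 3 (1951), 36–44, Thm. 1.
* J. Tate, *Global class field theory*, Ch. VII of Cassels–Fröhlich (1967), §4 Prop. 4.1.
  [CasselsFrohlichANT1967]
* J. Neukirch, *Algebraic Number Theory* (1999), Ch. VI §1 (1.7)–(1.9); Ch. VII §6 (6.13)–(6.14).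
  [NeukirchANT1999]
* S. Gelbart, *Three lectures on the modularity of `ρ̄_{E,3}` and the Langlands reciprocity
  conjecture* (1997), Prop. 4.1. [Gelbart1997]
-/

noncomputable section

open scoped NumberField nonZeroDivisors
open NumberField IsDedekindDomain Field Filter Topology Set
open Literature.NumberTheory.GaloisRepresentations (HeckeCharacter)

namespace Literature.NumberTheory.Automorphic

/-! ### One place at a time -/

section OnePlace

variable {F : Type} [Field F] [NumberField F]

open GaloisRepresentations in
/-- Finite components of a power of an idele. [folklore] -/
private theorem ideleGroup_val_snd_pow' (x : ideleGroup F) (u : HeightOneSpectrum (𝓞 F)) (k : ℕ) :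
    ((x ^ k : ideleGroup F) : AdeleRing (𝓞 F) F).2 u = ((x : AdeleRing (𝓞 F) F).2 u) ^ k := by
  induction k with
  | zero => rw [pow_zero, pow_zero]; rfl
  | succ k ih => rw [pow_succ, ideleGroup_val_snd_mul, ih, pow_succ]

open GaloisRepresentations NumberFields in
/-- **Jacquet–Langlands' Lemma 12.5 at one place, from Chevalley's theorem.**  Granting `Chev`
(Chevalley 1951, Thm. 1 for the `{v}`-units; module docstring): for finite places `w ≠ v`, a
finite set `S₀` of finite places and `N` there is a Hecke character `η` of `F` of finite order,
unramified at `v` and at every place of `S₀` other than `w`, with `η(ϖ_v) = 1`, such that `η^k` is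
ramified at `w` for all `0 < k ≤ N`.  `η` is the Hecke character (`heckeOfRayClass`) of an explicit
character of the ray class group modulo `𝔭_w^m ∏_{t ∈ T} 𝔭_t^{e_t}`; see the module docstring for
the proof. [cite: JacquetLanglands1970, Lemma 12.5]
[cite: CasselsFrohlichANT1967, Ch. VII §4 Prop. 4.1] -/
theorem exists_heckeCharacter_of_chevalley_one
    (Chev : ∀ (v w : HeightOneSpectrum (𝓞 F)), w ≠ v → ∀ (S₀ : Finset (HeightOneSpectrum (𝓞 F)))
      (m : ℕ), ∃ (T : Finset (HeightOneSpectrum (𝓞 F))) (e : HeightOneSpectrum (𝓞 F) → ℕ),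
        Disjoint T S₀ ∧ ∀ x : F, x ≠ 0 →
          (∀ u : HeightOneSpectrum (𝓞 F), u ≠ v → u.valuation F x = 1) →
          (∀ t ∈ T, t.valuation F (x - 1) ≤ WithZero.exp (-(e t : ℤ))) →
            w.valuation F (x - 1) ≤ WithZero.exp (-(m : ℤ)))
    (v w : HeightOneSpectrum (𝓞 F)) (hwv : w ≠ v) (S₀ : Finset (HeightOneSpectrum (𝓞 F)))
    (N : ℕ) :
    ∃ η : HeckeCharacter F, η.IsFiniteOrder ∧
      (∀ u : HeightOneSpectrum (𝓞 F), u ≠ w → (u = v ∨ u ∈ S₀) → η.IsUnramifiedAt u) ∧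
      η.valueAtUniformizer v = 1 ∧
      ∀ k : ℕ, 0 < k → k ≤ N → ¬ (η ^ k).IsUnramifiedAt w := by
  classical
  -- Step A: the global unit `a` at `w` and the exponent `m`
  obtain ⟨a, m₀, hav, ha0, hbad₀⟩ := exists_unit_pow_sub_one w N
  set m : ℕ := m₀ + 1 with hm
  have hm0 : m ≠ 0 := Nat.succ_ne_zero _
  have hbad : ∀ k : ℕ, 0 < k → k ≤ N → ¬ w.valuation F (a ^ k - 1) ≤ WithZero.exp (-(m : ℤ)) := by
    intro k hk hkN hle
    refine hbad₀ k hk hkN (hle.trans ?_)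
    rw [WithZero.exp_le_exp]; omega
  set aU : Fˣ := Units.mk0 a ha0 with haU
  -- Step B: the finite support of `a`, and the set of places to avoid
  have hfinA : {u : HeightOneSpectrum (𝓞 F) | u.valuation F a ≠ 1}.Finite := by
    have h := ideleOrd_eventually_eq_zero (GaloisRepresentations.principalIdele F aU)
    rw [Filter.eventually_cofinite] at h
    refine h.subset fun u hu => ?_
    rw [Set.mem_setOf_eq] at hu ⊢
    rw [ideleOrd_principalIdele, haU, Units.val_mk0]
    intro h0
    apply hu
    rw [neg_eq_zero] at h0
    rw [← WithZero.exp_log (x := u.valuation F a) ((Valuation.ne_zero_iff (u.valuation F)).mpr ha0),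
      h0, WithZero.exp_zero]
  set S₁ : Finset (HeightOneSpectrum (𝓞 F)) := S₀ ∪ hfinA.toFinset ∪ {v, w} with hS₁
  -- Step C: Chevalley's auxiliary primes
  obtain ⟨T, e, hTdisj, hChev⟩ := Chev v w hwv S₁ m
  have hTS₁ : ∀ t ∈ T, t ∉ S₁ := fun t ht hts => Finset.disjoint_left.mp hTdisj ht hts
  have hvT : v ∉ T := fun h => hTS₁ v h (by simp [hS₁])
  have hwT : w ∉ T := fun h => hTS₁ w h (by simp [hS₁])
  have haT : ∀ t ∈ T, t.valuation F a = 1 := by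
    intro t ht
    by_contra hne
    exact hTS₁ t ht (by simp [hS₁, hfinA.mem_toFinset, hne])
  -- Step D: the modulus `𝔪 = 𝔭_w^m ∏_{t ∈ T} 𝔭_t^{e t}`
  set s : Finset (HeightOneSpectrum (𝓞 F)) := insert w T with hs
  set n : HeightOneSpectrum (𝓞 F) → ℕ := fun u => if u = w then m else e u with hn
  set 𝔪 : Ideal (𝓞 F) := ∏ x ∈ s, x.asIdeal ^ n x with h𝔪def
  have h𝔪 : 𝔪 ≠ ⊥ := finsetProd_pow_ne_bot s n
  have hnw : n w = m := by simp [hn]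
  have hnt : ∀ t ∈ T, n t = e t := fun t ht => by
    have : t ≠ w := fun h => hwT (h ▸ ht)
    simp [hn, this]
  have hmw : m ≤ modulusExp 𝔪 w := hnw ▸ le_modulusExp_finsetProd s n (Finset.mem_insert_self w T)
  have hmt : ∀ t ∈ T, e t ≤ modulusExp 𝔪 t := fun t ht =>
    hnt t ht ▸ le_modulusExp_finsetProd s n (Finset.mem_insert_of_mem ht)
  have hle_of : ∀ {u : HeightOneSpectrum (𝓞 F)}, 𝔪 ≤ u.asIdeal → u = w ∨ u ∈ T := fun hu => by
    have h := (mem_of_finsetProd_le s n hu).1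
    rwa [hs, Finset.mem_insert] at h
  have hv𝔪 : ¬ 𝔪 ≤ v.asIdeal := fun h => by
    rcases hle_of h with h | h
    · exact hwv h.symm
    · exact hvT h
  haveI : Finite (RayClassGroup 𝔪) := finite_rayClassGroup h𝔪
  -- Step E: the local unit `a` at `w`, its idele, and a principal adjustment into `W_𝔪`
  have haint : Valued.v (a : w.adicCompletion F) ≤ 1 := by
    rw [HeightOneSpectrum.valuedAdicCompletion_eq_valuation', hav]
  set aO : w.adicCompletionIntegers F := ⟨(a : w.adicCompletion F), haint⟩ with haO
  have haOunit : IsUnit aO := by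
    rw [HeightOneSpectrum.adicCompletionIntegers.isUnit_iff_valued_eq_one]
    show Valued.v (a : w.adicCompletion F) = 1
    rw [HeightOneSpectrum.valuedAdicCompletion_eq_valuation', hav]
  set uO : (w.adicCompletionIntegers F)ˣ := haOunit.unit with huO
  set uK : (w.adicCompletion F)ˣ := Units.map ((w.adicCompletionIntegers F).subtype : _ →* _) uO
    with huK
  have huKval : (uK : w.adicCompletion F) = algebraMap F (w.adicCompletion F) a := rfl
  set y : ideleGroup F := GaloisRepresentations.localUnits w uK with hy
  obtain ⟨b, hb⟩ := exists_principalIdele_mul_mem_congruenceIdeles h𝔪 y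
  set z : ideleGroup F := GaloisRepresentations.principalIdele F b * y with hz
  -- components of `z`
  have hzw : (z : AdeleRing (𝓞 F) F).2 w =
      algebraMap F (w.adicCompletion F) b * algebraMap F (w.adicCompletion F) a := by
    rw [hz, ideleGroup_val_snd_mul, principalIdele_snd, hy, localUnits_snd_apply_self, huKval]
  have hzu : ∀ u : HeightOneSpectrum (𝓞 F), u ≠ w →
      (z : AdeleRing (𝓞 F) F).2 u = algebraMap F (u.adicCompletion F) b := by
    intro u hu
    rw [hz, ideleGroup_val_snd_mul, principalIdele_snd, hy, localUnits_snd_apply_of_ne _ hu,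
      mul_one]
  -- `b` is a unit at the primes of `𝔪`, so `(b)` is prime to `𝔪`
  have hexp_lt_one : ∀ {u : HeightOneSpectrum (𝓞 F)}, modulusExp 𝔪 u ≠ 0 →
      WithZero.exp (-(modulusExp 𝔪 u : ℤ)) < 1 := fun hne0 => by
    rw [← WithZero.exp_zero, WithZero.exp_lt_exp, neg_lt_zero, Int.natCast_pos]
    exact Nat.pos_of_ne_zero hne0
  have hz1 : ∀ {u : HeightOneSpectrum (𝓞 F)} {x : ideleGroup F}, x ∈ congruenceIdeles 𝔪 →
      modulusExp 𝔪 u ≠ 0 → Valued.v ((x : AdeleRing (𝓞 F) F).2 u) = 1 := by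
    intro u x hx hne0
    have hlt : Valued.v ((x : AdeleRing (𝓞 F) F).2 u - 1) < 1 :=
      ((mem_congruenceIdeles_iff.mp hx).1 u hne0).trans_lt (hexp_lt_one hne0)
    have := Valuation.map_eq_of_sub_lt Valued.v (x := (1 : u.adicCompletion F))
      (y := (x : AdeleRing (𝓞 F) F).2 u) (by rw [map_one]; exact hlt)
    rw [map_one] at this
    exact this
  have hmodw : modulusExp 𝔪 w ≠ 0 := fun h => hm0 (Nat.le_zero.mp (h ▸ hmw))
  have hbval : ∀ u : HeightOneSpectrum (𝓞 F), 𝔪 ≤ u.asIdeal → u.valuation F (b : F) = 1 := by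
    intro u hu
    have hne0 : modulusExp 𝔪 u ≠ 0 := (modulusExp_ne_zero_iff 𝔪 h𝔪 u).mpr hu
    have hzu1 := hz1 hb hne0
    rcases hle_of hu with rfl | huT
    · rw [hzw, map_mul, GaloisRepresentations.valued_algebraMap_adicCompletion,
        GaloisRepresentations.valued_algebraMap_adicCompletion, hav, mul_one] at hzu1
      exact hzu1
    · have huw : u ≠ w := fun h => hwT (h ▸ huT)
      rw [hzu u huw, GaloisRepresentations.valued_algebraMap_adicCompletion] at hzu1
      exact hzu1
  have hbI : toPrincipalIdeal (𝓞 F) F b ∈ idealsPrimeTo 𝔪 := by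
    intro u hu
    rw [count_toPrincipalIdeal, hbval u hu, WithZero.log_one, neg_zero]
  -- Step F: the character of the ray class group and the Hecke character
  set c : RayClassGroup 𝔪 := QuotientGroup.mk ⟨toPrincipalIdeal (𝓞 F) F b, hbI⟩ with hc
  set d : RayClassGroup 𝔪 := primeClass 𝔪 h𝔪 v with hd
  obtain ⟨χ, hχd, hχc⟩ := exists_monoidHom_apply_pow_eq_one_imp c (Subgroup.zpowers d)
  have hψ := isRayClassCharacter_primeClass h𝔪 χ
  set η : HeckeCharacter F := heckeOfRayClass h𝔪 hψ with hη
  refine ⟨η, heckeOfRayClass_isFiniteOrder h𝔪 hψ, fun u huw hu => ?_, ?_,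
    fun k hk hkN hunr => ?_⟩
  · -- unramified off `𝔪`
    refine heckeOfRayClass_isUnramifiedAt h𝔪 hψ fun hle => ?_
    rcases hle_of hle with h | h
    · exact huw h
    · rcases hu with rfl | hu
      · exact hvT h
      · exact hTS₁ u h (by simp [hS₁, hu])
  · -- the value at `v`
    rw [heckeOfRayClass_valueAtUniformizer h𝔪 hψ hv𝔪]
    show ((χ (primeClass 𝔪 h𝔪 v) : ℂˣ) : ℂ) = 1
    rw [← hd, hχd d (Subgroup.mem_zpowers d), Units.val_one]
  · -- ramification of `η^k` at `w`: evaluate at the local unit `a`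
    have hval : (η ^ k) y = 1 := by
      have := hunr uO
      rwa [HeckeCharacter.localComponent_apply] at this
    have hηy : η y = χ c := by
      have h1 : η y = η z := by
        rw [hz, map_mul,
          HeckeCharacter.map_principal η (GaloisRepresentations.principalIdele_mem b), one_mul]
      rw [h1, hη, heckeOfRayClass_apply_of_mem h𝔪 hψ hb, hz, rayIdeleValue_mul,
        rayIdeleValue_localUnits_of_valued_eq_one hψ w
          (by rw [huKval, GaloisRepresentations.valued_algebraMap_adicCompletion, hav]),
        mul_one, rayIdeleValue_principalIdele_eq_apply_mk h𝔪 χ b hbI]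
    have hck : χ (c ^ k) = 1 := by
      rw [map_pow, ← hηy, ← HeckeCharacter.pow_apply]
      exact hval
    obtain ⟨j, hj⟩ := Subgroup.mem_zpowers_iff.mp (hχc k hck)
    -- the relation `[𝔭_v]^j = [(b)]^k` in `Cl^𝔪`: `(b)^k 𝔭_v^{-j} = (r)` with `r ≡ 1 mod 𝔪`
    rw [hd, hc, primeClass_eq, ← QuotientGroup.mk_zpow, ← QuotientGroup.mk_pow, QuotientGroup.eq,
      Subgroup.mem_subgroupOf, mem_ray_iff] at hj
    obtain ⟨r, hr, hrI⟩ := hj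
    have hrI' : (toPrincipalIdeal (𝓞 F) F r : FractionalIdeal (𝓞 F)⁰ F) =
        ((((unitOfPrime 𝔪 h𝔪 v : idealsPrimeTo 𝔪) : (FractionalIdeal (𝓞 F)⁰ F)ˣ) :
            FractionalIdeal (𝓞 F)⁰ F) ^ j)⁻¹ *
          (toPrincipalIdeal (𝓞 F) F b : FractionalIdeal (𝓞 F)⁰ F) ^ k := by
      rw [hrI]
      simp only [Subgroup.coe_mul, Subgroup.coe_inv, Subgroup.coe_zpow, Subgroup.coe_pow,
        Units.val_mul, Units.val_inv_eq_inv_val, Units.val_zpow_eq_zpow_val,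
        Units.val_pow_eq_pow_val]
    -- counts of `(r)` off `v`
    have hcount : ∀ u : HeightOneSpectrum (𝓞 F), u ≠ v →
        FractionalIdeal.count F u (toPrincipalIdeal (𝓞 F) F r : FractionalIdeal (𝓞 F)⁰ F) =
          k * FractionalIdeal.count F u
            (toPrincipalIdeal (𝓞 F) F b : FractionalIdeal (𝓞 F)⁰ F) := by
      intro u huv
      have hP0 : ((((unitOfPrime 𝔪 h𝔪 v : idealsPrimeTo 𝔪) : (FractionalIdeal (𝓞 F)⁰ F)ˣ) :
            FractionalIdeal (𝓞 F)⁰ F) ^ j)⁻¹ ≠ 0 :=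
        inv_ne_zero (zpow_ne_zero _ (Units.ne_zero _))
      have hB0 : (toPrincipalIdeal (𝓞 F) F b : FractionalIdeal (𝓞 F)⁰ F) ^ k ≠ 0 :=
        pow_ne_zero _ (Units.ne_zero _)
      rw [hrI', FractionalIdeal.count_mul F u hP0 hB0, FractionalIdeal.count_inv,
        FractionalIdeal.count_zpow, FractionalIdeal.count_pow,
        coe_unitOfPrime_of_not_le h𝔪 hv𝔪, FractionalIdeal.count_maximal_coprime F u huv.symm]
      ring
    -- `x = b^k / r` is a unit at every place `≠ v`
    set x : F := (b : F) ^ k / (r : F) with hx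
    have hr0 : (r : F) ≠ 0 := r.ne_zero
    have hx0 : x ≠ 0 := div_ne_zero (pow_ne_zero _ b.ne_zero) hr0
    have hxval : ∀ u : HeightOneSpectrum (𝓞 F), u ≠ v → u.valuation F x = 1 := by
      intro u huv
      rw [hx, map_div₀, map_pow, valuation_eq_exp_neg_count u b, valuation_eq_exp_neg_count u r,
        hcount u huv]
      have e1 : WithZero.exp (-FractionalIdeal.count F u
          (toPrincipalIdeal (𝓞 F) F b : FractionalIdeal (𝓞 F)⁰ F)) ^ k =
          WithZero.exp (-((k : ℤ) * FractionalIdeal.count F u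
            (toPrincipalIdeal (𝓞 F) F b : FractionalIdeal (𝓞 F)⁰ F))) := by
        rw [← WithZero.exp_nsmul, nsmul_eq_mul, mul_neg]
      rw [e1, div_self WithZero.exp_ne_zero]
    -- ultrametric bookkeeping
    have hultra : ∀ (V : Valuation F (WithZero (Multiplicative ℤ))) (p q : F)
        (B : WithZero (Multiplicative ℤ)),
        V (p - 1) ≤ B → V (q - 1) ≤ B → V q = 1 → V (p / q - 1) ≤ B := by
      intro V p q B hp hq hq1
      have hq0 : q ≠ 0 := fun h => by rw [h, map_zero] at hq1; exact zero_ne_one hq1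
      have e : p / q - 1 = (p - 1 - (q - 1)) / q := by field_simp; ring
      rw [e, map_div₀, hq1, div_one]
      exact (Valuation.map_sub _ _ _).trans (max_le hp hq)
    -- the congruences of `x` at the auxiliary primes
    have hzk : z ^ k ∈ congruenceIdeles 𝔪 := Subgroup.pow_mem _ hb k
    have hbk : ∀ u : HeightOneSpectrum (𝓞 F), u ≠ w → modulusExp 𝔪 u ≠ 0 →
        u.valuation F ((b : F) ^ k - 1) ≤ WithZero.exp (-(modulusExp 𝔪 u : ℤ)) := by
      intro u huw hne0
      have h := (mem_congruenceIdeles_iff.mp hzk).1 u hne0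
      rwa [ideleGroup_val_snd_pow', hzu u huw, ← map_pow,
        ← map_one (algebraMap F (u.adicCompletion F)), ← map_sub,
        GaloisRepresentations.valued_algebraMap_adicCompletion] at h
    have hrval : ∀ u : HeightOneSpectrum (𝓞 F), modulusExp 𝔪 u ≠ 0 →
        u.valuation F ((r : F) - 1) ≤ WithZero.exp (-(modulusExp 𝔪 u : ℤ)) :=
      fun u hne0 => (mem_rayElements_iff.mp hr).1 u hne0
    have hr1 : ∀ u : HeightOneSpectrum (𝓞 F), modulusExp 𝔪 u ≠ 0 → u.valuation F (r : F) = 1 :=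
      fun u hne0 => valuation_eq_one_of_mem_rayElements hr hne0
    have hxT : ∀ t ∈ T, t.valuation F (x - 1) ≤ WithZero.exp (-(e t : ℤ)) := by
      intro t ht
      have htv : t ≠ v := fun h => hvT (h ▸ ht)
      have htw : t ≠ w := fun h => hwT (h ▸ ht)
      by_cases het : e t = 0
      · -- no condition: `x` is a `t`-adic unit
        rw [het, Nat.cast_zero, neg_zero, WithZero.exp_zero]
        calc t.valuation F (x - 1) ≤ max (t.valuation F x) (t.valuation F 1) :=
              Valuation.map_sub _ _ _
          _ = 1 := by rw [hxval t htv, map_one, max_self]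
      · have hne0 : modulusExp 𝔪 t ≠ 0 := fun h => het (Nat.le_zero.mp (h ▸ hmt t ht))
        have hmono : WithZero.exp (-(modulusExp 𝔪 t : ℤ)) ≤ WithZero.exp (-(e t : ℤ)) := by
          rw [WithZero.exp_le_exp, neg_le_neg_iff, Nat.cast_le]
          exact hmt t ht
        rw [hx]
        exact (hultra _ _ _ _ (hbk t htw hne0) (hrval t hne0) (hr1 t hne0)).trans hmono
    -- Chevalley: `x ≡ 1 mod 𝔭_w^m`
    have hxw : w.valuation F (x - 1) ≤ WithZero.exp (-(m : ℤ)) := hChev x hx0 hxval hxT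
    -- back to `b^k` and `a^k` at `w`
    have hmonow : WithZero.exp (-(modulusExp 𝔪 w : ℤ)) ≤ WithZero.exp (-(m : ℤ)) := by
      rw [WithZero.exp_le_exp, neg_le_neg_iff, Nat.cast_le]
      exact hmw
    have hrw : w.valuation F ((r : F) - 1) ≤ WithZero.exp (-(m : ℤ)) := (hrval w hmodw).trans hmonow
    have hbkw : w.valuation F ((b : F) ^ k - 1) ≤ WithZero.exp (-(m : ℤ)) := by
      have e : (b : F) ^ k - 1 = (x - 1) * (r : F) + ((r : F) - 1) := by
        rw [hx]; field_simp; ring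
      rw [e]
      refine (Valuation.map_add _ _ _).trans (max_le ?_ hrw)
      rw [map_mul, hr1 w hmodw, mul_one]
      exact hxw
    have hbakw : w.valuation F ((b : F) ^ k * a ^ k - 1) ≤ WithZero.exp (-(m : ℤ)) := by
      have h := (mem_congruenceIdeles_iff.mp hzk).1 w hmodw
      rw [ideleGroup_val_snd_pow', hzw, ← map_mul, ← map_pow,
        ← map_one (algebraMap F (w.adicCompletion F)), ← map_sub,
        GaloisRepresentations.valued_algebraMap_adicCompletion, mul_pow] at h
      exact h.trans hmonow
    refine hbad k hk hkN ?_
    have e : a ^ k - 1 = ((b : F) ^ k * a ^ k - 1) - a ^ k * ((b : F) ^ k - 1) := by ring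
    rw [e]
    refine (Valuation.map_sub _ _ _).trans (max_le hbakw ?_)
    rw [map_mul, map_pow, hav, one_pow, one_mul]
    exact hbkw

end OnePlace

/-! ### All places of `S`: products -/

section Product

variable {F : Type} [Field F] [NumberField F]

/-- The product of two Hecke characters unramified at `u` is unramified at `u`. [folklore] -/
private theorem isUnramifiedAt_mul' {η₁ η₂ : HeckeCharacter F} {u : HeightOneSpectrum (𝓞 F)}
    (h₁ : η₁.IsUnramifiedAt u) (h₂ : η₂.IsUnramifiedAt u) : (η₁ * η₂).IsUnramifiedAt u :=
    fun x => by
  have e : (η₁ * η₂).localComponent u = fun y => η₁.localComponent u y * η₂.localComponent u y := by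
    funext y; rfl
  show (η₁ * η₂).localComponent u _ = 1
  rw [e]
  simp only [h₁ x, h₂ x, mul_one]

/-- If `η₁ η₂` and `η₁` are unramified at `u`, so is `η₂`. [folklore] -/
private theorem isUnramifiedAt_of_mul' {η₁ η₂ : HeckeCharacter F} {u : HeightOneSpectrum (𝓞 F)}
    (h : (η₁ * η₂).IsUnramifiedAt u) (h₁ : η₁.IsUnramifiedAt u) : η₂.IsUnramifiedAt u := fun x => by
  have hx := h x
  have e : (η₁ * η₂).localComponent u = fun y => η₁.localComponent u y * η₂.localComponent u y := by
    funext y; rfl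
  rw [e] at hx
  simp only [h₁ x, one_mul] at hx
  exact hx

/-- Powers of a Hecke character unramified at `u` are unramified at `u`. [folklore] -/
private theorem isUnramifiedAt_pow' {η : HeckeCharacter F} {u : HeightOneSpectrum (𝓞 F)}
    (h : η.IsUnramifiedAt u) (k : ℕ) : (η ^ k).IsUnramifiedAt u := by
  induction k with
  | zero => intro x; rw [pow_zero]; rfl
  | succ k ih => rw [pow_succ]; exact isUnramifiedAt_mul' ih h

/-- **Jacquet–Langlands' Lemma 12.5 (order form) from Chevalley's theorem** — the hypothesis `Hη`
of `frobSatakeCompatibleAt_of_isPiOfArtinRep_both_of_heckeCharacters`.  Granting `Chev` (module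
docstring): for a finite place `v`, a finite set `S ∌ v` of finite places and `N` there is a Hecke
character `η` of finite order, unramified at `v` with `η(ϖ_v) = 1`, such that `η^k` is ramified at
every `w ∈ S` for all `0 < k ≤ N`.  Proof: multiply the characters of
`exists_heckeCharacter_of_chevalley_one` over `w ∈ S` (induction on `S`; the character for `w` is
unramified at the other places of `S`, and a product `η₁ η₂` with `η₁^k` unramified and `η₂^k`
ramified at `w` has `(η₁ η₂)^k` ramified at `w`). [cite: JacquetLanglands1970, Lemma 12.5] -/
theorem exists_heckeCharacter_of_chevalley
    (Chev : ∀ (v w : HeightOneSpectrum (𝓞 F)), w ≠ v → ∀ (S₀ : Finset (HeightOneSpectrum (𝓞 F)))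
      (m : ℕ), ∃ (T : Finset (HeightOneSpectrum (𝓞 F))) (e : HeightOneSpectrum (𝓞 F) → ℕ),
        Disjoint T S₀ ∧ ∀ x : F, x ≠ 0 →
          (∀ u : HeightOneSpectrum (𝓞 F), u ≠ v → u.valuation F x = 1) →
          (∀ t ∈ T, t.valuation F (x - 1) ≤ WithZero.exp (-(e t : ℤ))) →
            w.valuation F (x - 1) ≤ WithZero.exp (-(m : ℤ)))
    (v : HeightOneSpectrum (𝓞 F)) (S : Finset (HeightOneSpectrum (𝓞 F))) (hvS : v ∉ S) (N : ℕ) :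
    ∃ η : HeckeCharacter F, η.IsFiniteOrder ∧ η.IsUnramifiedAt v ∧ η.valueAtUniformizer v = 1 ∧
      ∀ w ∈ S, ∀ k : ℕ, 0 < k → k ≤ N → ¬ (η ^ k).IsUnramifiedAt w := by
  classical
  -- induction over the subsets of `S`, keeping track of unramifiedness on `S`
  suffices key : ∀ S' : Finset (HeightOneSpectrum (𝓞 F)), S' ⊆ S →
      ∃ η : HeckeCharacter F, η.IsFiniteOrder ∧ (∀ u ∈ S, u ∉ S' → η.IsUnramifiedAt u) ∧
        η.IsUnramifiedAt v ∧ η.valueAtUniformizer v = 1 ∧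
        ∀ w ∈ S', ∀ k : ℕ, 0 < k → k ≤ N → ¬ (η ^ k).IsUnramifiedAt w by
    obtain ⟨η, h1, -, h3, h4, h5⟩ := key S le_rfl
    exact ⟨η, h1, h3, h4, h5⟩
  intro S'
  induction S' using Finset.induction_on with
  | empty =>
      intro _
      refine ⟨1, IsOfFinOrder.one, fun u _ _ x => rfl, fun x => rfl, ?_,
        fun w hw => absurd hw (by simp)⟩
      rfl
  | insert w S' hwS' ih =>
      intro hsub
      have hwS : w ∈ S := hsub (Finset.mem_insert_self w S')
      have hwv : w ≠ v := fun h => hvS (h ▸ hwS)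
      obtain ⟨η₁, hfin₁, hunr₁, hv₁, hval₁, hram₁⟩ := ih ((Finset.subset_insert w S').trans hsub)
      obtain ⟨η₂, hfin₂, hunr₂, hval₂, hram₂⟩ :=
        exists_heckeCharacter_of_chevalley_one Chev v w hwv S N
      refine ⟨η₁ * η₂, hfin₁.mul hfin₂, fun u huS hu => ?_, ?_, ?_, fun w' hw' k hk hkN hunr => ?_⟩
      · have huw : u ≠ w := fun h => hu (h ▸ Finset.mem_insert_self w S')
        have huS' : u ∉ S' := fun h => hu (Finset.mem_insert_of_mem h)
        exact isUnramifiedAt_mul' (hunr₁ u huS huS') (hunr₂ u huw (Or.inr huS))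
      · exact isUnramifiedAt_mul' hv₁ (hunr₂ v hwv.symm (Or.inl rfl))
      · show (((η₁ * η₂).localComponent v (HeckeCharacter.uniformizer F v) : ℂˣ) : ℂ) = 1
        have e : (η₁ * η₂).localComponent v (HeckeCharacter.uniformizer F v) =
            η₁.localComponent v (HeckeCharacter.uniformizer F v) *
              η₂.localComponent v (HeckeCharacter.uniformizer F v) := rfl
        rw [e, Units.val_mul]
        change η₁.valueAtUniformizer v * η₂.valueAtUniformizer v = 1
        rw [hval₁, hval₂, mul_one]
      · rw [mul_pow] at hunr
        rcases Finset.mem_insert.mp hw' with rfl | hw'S'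
        · -- at the new place: `η₁^k` is unramified, `η₂^k` is not
          have h1 : (η₁ ^ k).IsUnramifiedAt w' := isUnramifiedAt_pow' (hunr₁ w' hwS hwS') k
          exact hram₂ k hk hkN (isUnramifiedAt_of_mul' hunr h1)
        · -- at an old place: `η₂^k` is unramified, `η₁^k` is not
          have hw'w : w' ≠ w := fun h => hwS' (h ▸ hw'S')
          have h2 : (η₂ ^ k).IsUnramifiedAt w' :=
            isUnramifiedAt_pow' (hunr₂ w' hw'w (Or.inr (hsub (Finset.mem_insert_of_mem hw'S')))) k
          rw [mul_comm] at hunr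
          exact hram₁ w' hw'S' k hk hkN (isUnramifiedAt_of_mul' hunr h2)

/-- **Gelbart's Prop. 4.1 — both unramified shadows — from Chevalley's congruence subgroup
theorem and the twisted Hecke theory of `GL(2)`.**  Hypotheses (displayed inline): `Chev` —
Chevalley 1951, Thm. 1 for the `{v}`-units of a number field (module docstring); `HT` — as in
`frobSatakeCompatibleAt_of_isPiOfArtinRep_both_of_heckeTheory` (Jacquet–Langlands 1970, Thm. 11.1,
Cor. 11.2, Thm. 2.18, Props. 3.5, 3.6, 3.8, with the unramified dictionary).  Conclusion:
`frobSatakeCompatibleAt_of_isPiOfArtinRep` and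
`frobSatakeCompatibleAt_of_isPiOfArtinRep_of_isUnramifiedAt` (Gelbart 1997, Prop. 4.1 at the
places where `π`, resp. `σ`, is unramified).  Proof:
`exists_heckeCharacter_of_chevalley` supplies the hypothesis `Hη` of
`frobSatakeCompatibleAt_of_isPiOfArtinRep_both_of_heckeCharacters`.
[cite: JacquetLanglands1970, Lemma 12.5, Thm. 11.1, proof of Thm. 12.2 pp. 209–211]
[cite: Gelbart1997, Prop. 4.1] -/
theorem frobSatakeCompatibleAt_of_isPiOfArtinRep_both_of_chevalley
    (Chev : ∀ {F : Type} [Field F] [NumberField F] (v w : HeightOneSpectrum (𝓞 F)), w ≠ v →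
      ∀ (S₀ : Finset (HeightOneSpectrum (𝓞 F))) (m : ℕ),
      ∃ (T : Finset (HeightOneSpectrum (𝓞 F))) (e : HeightOneSpectrum (𝓞 F) → ℕ),
        Disjoint T S₀ ∧ ∀ x : F, x ≠ 0 →
          (∀ u : HeightOneSpectrum (𝓞 F), u ≠ v → u.valuation F x = 1) →
          (∀ t ∈ T, t.valuation F (x - 1) ≤ WithZero.exp (-(e t : ℤ))) →
            w.valuation F (x - 1) ≤ WithZero.exp (-(m : ℤ)))
    (HT : ∀ {F : Type} [Field F] [NumberField F] (hcpt : isCompact_glFiniteIntegralLevel 2 F)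
      (π : CuspidalAutomorphicRepData 2 F hcpt),
      ∃ Nπ : HeightOneSpectrum (𝓞 F) → ℕ, ∀ χ : absoluteGaloisGroup F →ₜ* ℂˣ,
      ∃ (P P' : HeightOneSpectrum (𝓞 F) → Polynomial ℂ) (Λ Λ' Γ Γ' ε : ℂ → ℂ) (c : ℝ),
        (∀ u, (P u).eval 0 = 1 ∧ (P u).natDegree ≤ 2) ∧
        (∀ u, (P' u).eval 0 = 1 ∧ (P' u).natDegree ≤ 2) ∧
        Meromorphic Λ ∧ Meromorphic Λ' ∧ Differentiable ℂ Γ ∧ Differentiable ℂ Γ' ∧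
        (∃ Y : Set ℝ, Y.Finite ∧ ∀ s, Γ s = 0 → s.im ∈ Y) ∧
        (∃ Y : Set ℝ, Y.Finite ∧ ∀ s, Γ' s = 0 → s.im ∈ Y) ∧
        Continuous ε ∧ (∀ s, ε s ≠ 0) ∧ 1 ≤ c ∧
        (∀ s : ℂ, c < s.re →
          (Multipliable fun u : HeightOneSpectrum (𝓞 F) =>
              ((P u).eval ((u.residueCard : ℂ) ^ (-s)))⁻¹) ∧
            (∀ u, (P u).eval ((u.residueCard : ℂ) ^ (-s)) ≠ 0) ∧
            Λ s * Γ s =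
              ∏' u : HeightOneSpectrum (𝓞 F), ((P u).eval ((u.residueCard : ℂ) ^ (-s)))⁻¹) ∧
        (∀ s : ℂ, c < s.re →
          (Multipliable fun u : HeightOneSpectrum (𝓞 F) =>
              ((P' u).eval ((u.residueCard : ℂ) ^ (-s)))⁻¹) ∧
            (∀ u, (P' u).eval ((u.residueCard : ℂ) ^ (-s)) ≠ 0) ∧
            Λ' s * Γ' s =
              ∏' u : HeightOneSpectrum (𝓞 F), ((P' u).eval ((u.residueCard : ℂ) ^ (-s)))⁻¹) ∧
        (∀ s, Λ s = ε s * Λ' (1 - s)) ∧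
        (∀ (u : HeightOneSpectrum (𝓞 F)) (α : Multiset ℂ), π.1.HasSatakeParamAt u α →
          (∀ 𝔓 ∈ u.primesAbove, ∀ g ∈ 𝔓.inertia (absoluteGaloisGroup F), χ g = 1) →
          ∀ 𝔓 ∈ u.primesAbove, ∀ g : absoluteGaloisGroup F, IsArithFrobAt (𝓞 F) g 𝔓 →
            P u = eulerPolynomial (α.map fun a => a * (χ g : ℂ)) ∧
              P' u = eulerPolynomial (α.map fun a => a⁻¹ * (χ g : ℂ)⁻¹)) ∧
        (∀ (u : HeightOneSpectrum (𝓞 F)) (α : Multiset ℂ), π.1.HasSatakeParamAt u α →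
          (∃ 𝔓 ∈ u.primesAbove, ∃ g ∈ 𝔓.inertia (absoluteGaloisGroup F), χ g ≠ 1) →
            P u = 1 ∧ P' u = 1) ∧
        (∀ u : HeightOneSpectrum (𝓞 F),
          (∀ 𝔓 ∈ u.primesAbove, ∃ g ∈ 𝔓.inertia (absoluteGaloisGroup F),
            ∀ k : ℕ, 0 < k → k ≤ Nπ u → χ g ^ k ≠ 1) → P u = 1 ∧ P' u = 1) ∧
        (∀ u : HeightOneSpectrum (𝓞 F),
          (∀ 𝔓 ∈ u.primesAbove, ∀ g ∈ 𝔓.inertia (absoluteGaloisGroup F), χ g = 1) →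
          (∀ 𝔓 ∈ u.primesAbove, ∀ g : absoluteGaloisGroup F,
            IsArithFrobAt (𝓞 F) g 𝔓 → χ g = 1) →
          (P u).natDegree = 2 →
            ∃ B : Multiset ℂ, (0 : ℂ) ∉ B ∧ P u = eulerPolynomial B ∧
              π.1.HasSatakeParamAt u B)) :
    frobSatakeCompatibleAt_of_isPiOfArtinRep ∧
      frobSatakeCompatibleAt_of_isPiOfArtinRep_of_isUnramifiedAt :=
  frobSatakeCompatibleAt_of_isPiOfArtinRep_both_of_heckeCharacters
    (fun v S hvS N => exists_heckeCharacter_of_chevalley Chev v S hvS N) HT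

end Product

end Literature.NumberTheory.Automorphic

end
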